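import Literature.NumberTheory.Automorphic.U21RootMonomials      -- ★ p831696 (A-p14 (g23)): N3c `u21E/F/e/f/h`, `u21Mon`, derivation formulas, `q`-reduction
import Literature.Algebra.Lie.Sl2ExplicitStringTensor             -- ★ p831889 (A-p14 (g23)): N3d `strE/strF/strH`, `finrank_weightVectors_range_le`
import HarnessLib

/-!
# `U(2,1)`: the `𝔰𝔩₂`-strings of a level `M_{a,b}` modulo lower levels, and the bound on its highest weight vectors

Topic `NumberTheory/Automorphic`; namespace `Literature.NumberTheory.Automorphic`.  Two DEFINITIONS with bodies (`u21SVec`, `u21StrMap`) and theorems;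
no named fact, no instance, no notation, no `sorry`.  Cell `hodgecm-mathlib`, F0∕P3, T1a arch line, road «V19 in-house for `U(2,1)`» (registered pay-down line
`Cruxes/H413/Lines/F0_T1a_V19KTypeGrowthPaydown.lean`, open stub `stub_N3 : LevelBound₂₁`), node **N3e-1** (seat A-p14 (g23); LEAD F0P3b-p01 (g2)).

THE MATHEMATICS ([Varadarajan1989, §5.4]; [BorelWallach2000, II §4.2]; [Humphreys1972, §7.2]).  `V` a `(𝔤, K)`-module of `U(2,1)` with scalar
Casimir, `W₀ ⊂ V` a `K`-stable subspace, `M_{a,b} = F^b E^a W₀` the level `(a,b)` (★ `upqLevel`), `n = a + b`.  With the monomials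
`M(j,k,i,l) = F₀^j F₁^k E₀^i E₁^l` of ★ N3c put, for `0 ≤ t ≤ n`,
  `v_t := (−1)^{t−a} M(t−a, b−(t−a), a−t, min(t,a))`   (`= M(0,b,a−t,t)` for `t ≤ a`, `= (−1)^s M(s,b−s,0,a)` for `t = a+s`)
— the `n+1` REDUCED monomial families.  §1: modulo the lower level `M_{a−1,b−1}` (★ `q`-reduction) they form a STANDARD STRING tensored with `W₀`:
  `e v_t x ≡ v_t (e x) + t v_{t−1} x`,  `f v_t x ≡ v_t (f x) + (n−t) v_{t+1} x`,  `h v_t x = v_t (h x) + (n − 2t) v_t x`   (`x ∈ W₀`),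
and `M_{a,b} ⊆ Σ_t v_t W₀ + M_{a−1,b−1}`; `e, f, h` preserve `M_{a,b}`.  §2: hence for any subspace `L' ⊇ M_{a−1,b−1}` stable under `e, f, h` the map
`Ψ : (Fin (n+1) → W₀) → V ⧸ L'`, `w ↦ Σ_t [v_t w_t]` intertwines the explicit string module `V(n) ⊗ W₀` of ★ N3d (`strE, strF, strH` for the
restrictions `e|W₀, f|W₀, h|W₀`) with the operators induced on `V ⧸ L'`, and its range contains the image of `M_{a,b}`.  §3: by ★ N3d
`finrank_weightVectors_range_le` (complete reducibility of `V(n) ⊗ W₀`), **the `ē`-killed `h̄`-eigenvectors of eigenvalue `μ` in the image of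
`M_{a,b}` in `V ⧸ L'` number at most `dim (W₀)_{μ−n}`** (`(W₀)_ν` the `ν`-eigenspace of `h|W₀`) — none unless `μ − n` is an `h`-weight of `W₀`.

HONEST LABEL: kernel theorems about abstract `(𝔤, K)`-modules of `U(2,1)`; nothing printed about HC_CM is discharged here.  HC_CM is proved only modulo
the 2 remaining named inputs (hLiu418, h413) until rung 0 closes.

## References
* V. S. Varadarajan, *An Introduction to Harmonic Analysis on Semisimple Lie Groups* (1989), §5.4. [Varadarajan1989]
* A. Borel, N. Wallach, *Continuous Cohomology, Discrete Subgroups, and Representations of Reductive Groups*, 2nd ed. (2000), II §4.2. [BorelWallach2000]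
* J. E. Humphreys, *Introduction to Lie Algebras and Representation Theory*, GTM 9 (1972), §7.2. [Humphreys1972]
-/

-- Mathlib idiom (as in ★ `GKModules` and every `(𝔤, K)` file of the tree): the commutator bracket on `Module.End ℂ V` and on matrices, needed to
-- MENTION `ρ𝔤 : (uFormGroup α β).lie →ₗ⁅ℝ⁆ Module.End ℂ V` (`LieRing.ofAssociativeRing` is a `def` in Mathlib, not a global instance).
attribute [local instance 100] LieRing.ofAssociativeRing

set_option autoImplicit false

open scoped MatrixGroups Matrix ComplexConjugate

noncomputable section

namespace Literature.NumberTheory.Automorphic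

open Literature.RepresentationTheory Literature.RepresentationTheory.BorelWallach2000 Literature.RepresentationTheory.KonnoKonno2007
open Literature.Algebra.Lie

variable {V : Type*} [AddCommGroup V] [Module ℂ V]
  (ρK : Representation ℂ (uFormGroup (Fin 2) (Fin 1)).maximalCompact V) (ρ𝔤 : (uFormGroup (Fin 2) (Fin 1)).lie →ₗ⁅ℝ⁆ Module.End ℂ V)

/-! ## §1 The string vectors `v_t` -/

/-- **`v_t := (−1)^{t−a} M(t−a, b−(t−a), a−t, min(t,a))`**, `0 ≤ t ≤ a+b`: the reduced monomial families of level `(a,b)`, normalised as a standard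
string (`= M(0,b,a−t,t)` for `t ≤ a`, `= (−1)^s M(s,b−s,0,a)` for `t = a + s`). [cite: Varadarajan1989, §5.4] [cite: Humphreys1972, §7.2] -/
def u21SVec (a b t : ℕ) : Module.End ℂ V := ((-1 : ℂ) ^ (t - a)) • u21Mon ρ𝔤 (t - a) (b - (t - a)) (a - t) (min t a)

/-- `v_t` for `t ≤ a`: `M(0, b, a−t, t)`. [cite: Varadarajan1989, §5.4] -/
theorem u21SVec_of_le {a b t : ℕ} (ht : t ≤ a) : u21SVec ρ𝔤 a b t = u21Mon ρ𝔤 0 b (a - t) t := by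
  rw [u21SVec, Nat.sub_eq_zero_of_le ht, pow_zero, one_smul, Nat.sub_zero, min_eq_left ht]

/-- `v_{a+s} = (−1)^s M(s, b−s, 0, a)`. [cite: Varadarajan1989, §5.4] -/
theorem u21SVec_add (a b s : ℕ) : u21SVec ρ𝔤 a b (a + s) = ((-1 : ℂ) ^ s) • u21Mon ρ𝔤 s (b - s) 0 a := by
  rw [u21SVec, Nat.add_sub_cancel_left, Nat.sub_eq_zero_of_le (Nat.le_add_right a s), min_eq_right (Nat.le_add_right a s)]

variable {ρ𝔤}

/-- **`v_t x ∈ M_{a,b}`** for `x ∈ W₀`, `t ≤ a + b`. [cite: Varadarajan1989, §5.4] -/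
theorem u21SVec_apply_mem_upqLevel {W₀ : Submodule ℂ V} {a b t : ℕ} (ht : t ≤ a + b) {x : V} (hx : x ∈ W₀) :
    u21SVec ρ𝔤 a b t x ∈ upqLevel ρ𝔤 W₀ a b := by
  rw [u21SVec, LinearMap.smul_apply]
  refine Submodule.smul_mem _ _ ?_
  have h := u21Mon_apply_mem_upqLevel (ρ𝔤 := ρ𝔤) (W₀ := W₀) (t - a) (b - (t - a)) (a - t) (min t a) hx
  rwa [show a - t + min t a = a by omega, show t - a + (b - (t - a)) = b by omega] at h

/-- **`h v_t = v_t h + (n − 2t) v_t`** (`n = a + b`, `t ≤ n`): `v_t W₀` has `h`-weight shifted by `n − 2t`. [cite: Varadarajan1989, §5.4] [cite: Humphreys1972, §7.2 Lemma (a)] -/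
theorem u21h_mul_u21SVec {a b t : ℕ} (ht : t ≤ a + b) :
    u21h ρ𝔤 * u21SVec ρ𝔤 a b t = u21SVec ρ𝔤 a b t * u21h ρ𝔤 + (((a + b : ℕ) : ℂ) - 2 * t) • u21SVec ρ𝔤 a b t := by
  rw [u21SVec, mul_smul_comm, smul_mul_assoc, u21h_mul_u21Mon, smul_add, smul_comm]
  congr 2
  push_cast
  rcases Nat.lt_or_ge a t with hta | hta
  · rw [Nat.cast_sub (show t - a ≤ b by omega), Nat.cast_sub hta.le, Nat.sub_eq_zero_of_le hta.le, min_eq_right hta.le]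
    push_cast; ring
  · rw [Nat.cast_sub (show t - a ≤ b by omega), Nat.cast_sub hta, Nat.sub_eq_zero_of_le hta, min_eq_left hta]
    push_cast; ring

/-- **`e v_t x ≡ v_t (e x) + t v_{t−1} x  (mod M_{a−1,b−1})`** for `x ∈ W₀`, `t ≤ a+b` (`W₀` `K`-stable, Casimir scalar; for `t ≤ a` the congruence is an
identity, for `t > a` one `q`-reduction ★ `u21Mon_succ_add_u21Mon_succ_apply_mem` is used). [cite: Varadarajan1989, §5.4] [cite: Humphreys1972, §7.2 Lemma (b)] -/
theorem u21e_u21SVec_apply_sub_mem (hV : IsGKModule (uFormGroup (Fin 2) (Fin 1)) ρK ρ𝔤) {c : ℂ}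
    (hC : upqCasimirOp ρ𝔤 = algebraMap ℂ (Module.End ℂ V) c) {W₀ : Submodule ℂ V}
    (hW₀ : ∀ (k : (uFormGroup (Fin 2) (Fin 1)).maximalCompact), ∀ w ∈ W₀, ρK k w ∈ W₀) {a b t : ℕ} (ht : t ≤ a + b) {x : V} (hx : x ∈ W₀) :
    u21e ρ𝔤 (u21SVec ρ𝔤 a b t x) - (u21SVec ρ𝔤 a b t (u21e ρ𝔤 x) + (t : ℂ) • u21SVec ρ𝔤 a b (t - 1) x) ∈ upqLevel ρ𝔤 W₀ (a - 1) (b - 1) := by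
  rcases Nat.lt_or_ge a t with hta | hta
  · -- `t = a + s`, `s ≥ 1`: one `q`-reduction, with the factor `a`
    obtain ⟨s, rfl⟩ := Nat.exists_eq_add_of_lt hta
    have hs1 : s + 1 ≤ b := by omega
    have h1 : u21SVec ρ𝔤 a b (a + s + 1) = ((-1 : ℂ) ^ (s + 1)) • u21Mon ρ𝔤 (s + 1) (b - (s + 1)) 0 a := by
      rw [add_assoc]; exact u21SVec_add ρ𝔤 a b (s + 1)
    have h2 : u21SVec ρ𝔤 a b (a + s + 1 - 1) = ((-1 : ℂ) ^ s) • u21Mon ρ𝔤 s (b - s) 0 a := by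
      rw [Nat.add_sub_cancel]; exact u21SVec_add ρ𝔤 a b s
    have he := u21e_mul_u21Mon (ρ𝔤 := ρ𝔤) (s + 1) (b - (s + 1)) 0 a
    rw [Nat.add_sub_cancel, show b - (s + 1) + 1 = b - s by omega, Nat.zero_add] at he
    have he' := LinearMap.congr_fun he x
    simp only [LinearMap.add_apply, LinearMap.sub_apply, Module.End.mul_apply, LinearMap.smul_apply] at he'
    -- the `q`-reduction: `M(s+1, b-s-1, 1, a-1) x + M(s, b-s, 0, a) x ∈ M_{a-1, b-1}` (if `a ≥ 1`; if `a = 0` the term has coefficient `0`)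
    have hq : (a : ℂ) • (u21Mon ρ𝔤 (s + 1) (b - (s + 1)) 1 (a - 1) x + u21Mon ρ𝔤 s (b - s) 0 a x) ∈ upqLevel ρ𝔤 W₀ (a - 1) (b - 1) := by
      rcases Nat.eq_zero_or_pos a with rfl | ha
      · rw [Nat.cast_zero, zero_smul]; exact Submodule.zero_mem _
      · refine Submodule.smul_mem _ _ ?_
        have h := u21Mon_succ_add_u21Mon_succ_apply_mem ρK hV hC hW₀ s (b - (s + 1)) 0 (a - 1) hx
        rwa [Nat.zero_add, show b - (s + 1) + 1 = b - s by omega, Nat.sub_add_cancel ha, Nat.zero_add, show s + (b - (s + 1)) = b - 1 by omega] at h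
    have key : u21e ρ𝔤 (u21SVec ρ𝔤 a b (a + s + 1) x) - (u21SVec ρ𝔤 a b (a + s + 1) (u21e ρ𝔤 x) +
        ((a + s + 1 : ℕ) : ℂ) • u21SVec ρ𝔤 a b (a + s + 1 - 1) x) =
        ((-1 : ℂ) ^ (s + 1)) • ((a : ℂ) • (u21Mon ρ𝔤 (s + 1) (b - (s + 1)) 1 (a - 1) x + u21Mon ρ𝔤 s (b - s) 0 a x)) := by
      rw [h1, h2]
      simp only [LinearMap.smul_apply, map_smul, he', ← Nat.cast_smul_eq_nsmul ℂ, smul_add, smul_sub, pow_succ, smul_smul]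
      push_cast
      module
    rw [key]
    exact Submodule.smul_mem _ _ hq
  · -- `t ≤ a`: exact identity `e M(0,b,a-t,t) = M e + t M(0,b,a-t+1,t-1)`
    have h1 := u21SVec_of_le ρ𝔤 (b := b) hta
    have he := u21e_mul_u21Mon (ρ𝔤 := ρ𝔤) 0 b (a - t) t
    rw [zero_nsmul, sub_zero] at he
    have key : u21e ρ𝔤 (u21SVec ρ𝔤 a b t x) - (u21SVec ρ𝔤 a b t (u21e ρ𝔤 x) + (t : ℂ) • u21SVec ρ𝔤 a b (t - 1) x) = 0 := by
      rcases Nat.eq_zero_or_pos t with rfl | ht0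
      · rw [h1, ← Module.End.mul_apply, he, zero_nsmul, add_zero, Nat.cast_zero, zero_smul, add_zero, Module.End.mul_apply, sub_self]
      · have h2 : u21SVec ρ𝔤 a b (t - 1) = u21Mon ρ𝔤 0 b (a - t + 1) (t - 1) := by
          rw [u21SVec_of_le ρ𝔤 (show t - 1 ≤ a by omega), show a - (t - 1) = a - t + 1 by omega]
        rw [h1, h2, ← Module.End.mul_apply, he, LinearMap.add_apply, Module.End.mul_apply, LinearMap.smul_apply, Nat.cast_smul_eq_nsmul, sub_self]
    rw [key]
    exact Submodule.zero_mem _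

/-- **`f v_t x ≡ v_t (f x) + (n − t) v_{t+1} x  (mod M_{a−1,b−1})`** for `x ∈ W₀`, `t ≤ a + b` (for `t ≥ a` an identity, for `t < a` one `q`-reduction).
[cite: Varadarajan1989, §5.4] [cite: Humphreys1972, §7.2 Lemma (c)] -/
theorem u21f_u21SVec_apply_sub_mem (hV : IsGKModule (uFormGroup (Fin 2) (Fin 1)) ρK ρ𝔤) {c : ℂ}
    (hC : upqCasimirOp ρ𝔤 = algebraMap ℂ (Module.End ℂ V) c) {W₀ : Submodule ℂ V}
    (hW₀ : ∀ (k : (uFormGroup (Fin 2) (Fin 1)).maximalCompact), ∀ w ∈ W₀, ρK k w ∈ W₀) {a b t : ℕ} (ht : t ≤ a + b) {x : V} (hx : x ∈ W₀) :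
    u21f ρ𝔤 (u21SVec ρ𝔤 a b t x) - (u21SVec ρ𝔤 a b t (u21f ρ𝔤 x) + (((a + b : ℕ) : ℂ) - t) • u21SVec ρ𝔤 a b (t + 1) x) ∈
      upqLevel ρ𝔤 W₀ (a - 1) (b - 1) := by
  rcases Nat.lt_or_ge t a with hta | hta
  · -- `t < a`: one `q`-reduction, with the factor `b`
    have h1 := u21SVec_of_le ρ𝔤 (b := b) hta.le
    have h2 : u21SVec ρ𝔤 a b (t + 1) = u21Mon ρ𝔤 0 b (a - t - 1) (t + 1) := by
      rw [u21SVec_of_le ρ𝔤 (show t + 1 ≤ a by omega), Nat.sub_add_eq]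
    have hf := u21f_mul_u21Mon (ρ𝔤 := ρ𝔤) 0 b (a - t) t
    rw [Nat.zero_add] at hf
    have hf' := LinearMap.congr_fun hf x
    simp only [LinearMap.add_apply, LinearMap.sub_apply, Module.End.mul_apply, LinearMap.smul_apply] at hf'
    have hq : (b : ℂ) • (u21Mon ρ𝔤 1 (b - 1) (a - t) t x + u21Mon ρ𝔤 0 b (a - t - 1) (t + 1) x) ∈ upqLevel ρ𝔤 W₀ (a - 1) (b - 1) := by
      rcases Nat.eq_zero_or_pos b with rfl | hb
      · rw [Nat.cast_zero, zero_smul]; exact Submodule.zero_mem _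
      · refine Submodule.smul_mem _ _ ?_
        have h := u21Mon_succ_add_u21Mon_succ_apply_mem ρK hV hC hW₀ 0 (b - 1) (a - t - 1) t hx
        rwa [Nat.zero_add, Nat.sub_add_cancel hb, show a - t - 1 + 1 = a - t by omega, show a - t - 1 + t = a - 1 by omega, Nat.zero_add] at h
    have key : u21f ρ𝔤 (u21SVec ρ𝔤 a b t x) - (u21SVec ρ𝔤 a b t (u21f ρ𝔤 x) + (((a + b : ℕ) : ℂ) - t) • u21SVec ρ𝔤 a b (t + 1) x) =
        -((b : ℂ) • (u21Mon ρ𝔤 1 (b - 1) (a - t) t x + u21Mon ρ𝔤 0 b (a - t - 1) (t + 1) x)) := by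
      rw [h1, h2, hf']
      simp only [smul_add, ← Nat.cast_smul_eq_nsmul ℂ]
      rw [Nat.cast_sub hta.le]
      push_cast
      module
    rw [key]
    exact Submodule.neg_mem _ hq
  · -- `t = a + s`: exact identity `f M(s,b-s,0,a) = M f - (b-s) M(s+1,b-s-1,0,a)`
    obtain ⟨s, rfl⟩ := Nat.exists_eq_add_of_le hta
    have h1 := u21SVec_add ρ𝔤 a b s
    have h2 : u21SVec ρ𝔤 a b (a + s + 1) = ((-1 : ℂ) ^ (s + 1)) • u21Mon ρ𝔤 (s + 1) (b - s - 1) 0 a := by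
      rw [add_assoc, u21SVec_add, Nat.sub_add_eq]
    have hf := u21f_mul_u21Mon (ρ𝔤 := ρ𝔤) s (b - s) 0 a
    rw [zero_nsmul, add_zero] at hf
    have hf' := LinearMap.congr_fun hf x
    simp only [LinearMap.sub_apply, Module.End.mul_apply, LinearMap.smul_apply] at hf'
    have key : u21f ρ𝔤 (u21SVec ρ𝔤 a b (a + s) x) - (u21SVec ρ𝔤 a b (a + s) (u21f ρ𝔤 x) + (((a + b : ℕ) : ℂ) - ((a + s : ℕ) : ℂ)) • u21SVec ρ𝔤 a b (a + s + 1) x) = 0 := by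
      rw [h1, h2]
      simp only [LinearMap.smul_apply, map_smul, hf', smul_sub, ← Nat.cast_smul_eq_nsmul ℂ, pow_succ, smul_smul]
      rw [Nat.cast_sub (show s ≤ b by omega)]
      push_cast
      module
    rw [key]
    exact Submodule.zero_mem _

/-- `e` preserves the level `M_{a,b}`. [cite: BorelWallach2000, II §4.2] -/
theorem u21e_apply_mem_upqLevel {W₀ : Submodule ℂ V} (hW₀e : ∀ x ∈ W₀, u21e ρ𝔤 x ∈ W₀) (a b : ℕ) {v : V} (hv : v ∈ upqLevel ρ𝔤 W₀ a b) :
    u21e ρ𝔤 v ∈ upqLevel ρ𝔤 W₀ a b := by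
  rw [upqLevel_eq_span_u21Mon ρ𝔤 W₀ a b] at hv ⊢
  refine Submodule.span_induction (fun y hy => ?_) (by simp) (fun y z _ _ hy hz => by simpa using add_mem hy hz)
    (fun r y _ hy => by simpa using Submodule.smul_mem _ r hy) hv
  obtain ⟨j, hj, i, hi, w, hw, rfl⟩ := hy
  rw [← Module.End.mul_apply, u21e_mul_u21Mon]
  simp only [LinearMap.add_apply, LinearMap.sub_apply, Module.End.mul_apply, LinearMap.smul_apply]
  refine add_mem (sub_mem (Submodule.subset_span ⟨j, hj, i, hi, _, hW₀e w hw, rfl⟩) ?_) ?_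
  · rcases Nat.eq_zero_or_pos j with rfl | hj0
    · rw [zero_nsmul]; exact Submodule.zero_mem _
    · refine nsmul_mem (Submodule.subset_span ?_) j
      exact ⟨j - 1, by omega, i, hi, w, hw, by rw [show b - (j - 1) = b - j + 1 by omega]⟩
  · rcases Nat.eq_zero_or_pos (a - i) with h0 | h0
    · rw [h0, zero_nsmul]; exact Submodule.zero_mem _
    · refine nsmul_mem (Submodule.subset_span ?_) (a - i)
      exact ⟨j, hj, i + 1, by omega, w, hw, by rw [show a - (i + 1) = a - i - 1 by omega]⟩

/-- `f` preserves the level `M_{a,b}`. [cite: BorelWallach2000, II §4.2] -/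
theorem u21f_apply_mem_upqLevel {W₀ : Submodule ℂ V} (hW₀f : ∀ x ∈ W₀, u21f ρ𝔤 x ∈ W₀) (a b : ℕ) {v : V} (hv : v ∈ upqLevel ρ𝔤 W₀ a b) :
    u21f ρ𝔤 v ∈ upqLevel ρ𝔤 W₀ a b := by
  rw [upqLevel_eq_span_u21Mon ρ𝔤 W₀ a b] at hv ⊢
  refine Submodule.span_induction (fun y hy => ?_) (by simp) (fun y z _ _ hy hz => by simpa using add_mem hy hz)
    (fun r y _ hy => by simpa using Submodule.smul_mem _ r hy) hv
  obtain ⟨j, hj, i, hi, w, hw, rfl⟩ := hy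
  rw [← Module.End.mul_apply, u21f_mul_u21Mon]
  simp only [LinearMap.add_apply, LinearMap.sub_apply, Module.End.mul_apply, LinearMap.smul_apply]
  refine add_mem (sub_mem (Submodule.subset_span ⟨j, hj, i, hi, _, hW₀f w hw, rfl⟩) ?_) ?_
  · rcases Nat.eq_zero_or_pos (b - j) with h0 | h0
    · rw [h0, zero_nsmul]; exact Submodule.zero_mem _
    · refine nsmul_mem (Submodule.subset_span ?_) (b - j)
      exact ⟨j + 1, by omega, i, hi, w, hw, by rw [show b - (j + 1) = b - j - 1 by omega]⟩
  · rcases Nat.eq_zero_or_pos i with rfl | hi0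
    · rw [zero_nsmul]; exact Submodule.zero_mem _
    · refine nsmul_mem (Submodule.subset_span ?_) i
      exact ⟨j, hj, i - 1, by omega, w, hw, by rw [show a - (i - 1) = a - i + 1 by omega]⟩

/-- `h` preserves the level `M_{a,b}`. [cite: BorelWallach2000, II §4.2] -/
theorem u21h_apply_mem_upqLevel {W₀ : Submodule ℂ V} (hW₀h : ∀ x ∈ W₀, u21h ρ𝔤 x ∈ W₀) (a b : ℕ) {v : V} (hv : v ∈ upqLevel ρ𝔤 W₀ a b) :
    u21h ρ𝔤 v ∈ upqLevel ρ𝔤 W₀ a b := by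
  rw [upqLevel_eq_span_u21Mon ρ𝔤 W₀ a b] at hv ⊢
  refine Submodule.span_induction (fun y hy => ?_) (by simp) (fun y z _ _ hy hz => by simpa using add_mem hy hz)
    (fun r y _ hy => by simpa using Submodule.smul_mem _ r hy) hv
  obtain ⟨j, hj, i, hi, w, hw, rfl⟩ := hy
  rw [← Module.End.mul_apply, u21h_mul_u21Mon]
  simp only [LinearMap.add_apply, Module.End.mul_apply, LinearMap.smul_apply]
  exact add_mem (Submodule.subset_span ⟨j, hj, i, hi, _, hW₀h w hw, rfl⟩) (Submodule.smul_mem _ _ (Submodule.subset_span ⟨j, hj, i, hi, w, hw, rfl⟩))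

/-- **`M_{a,b} ⊆ Σ_t v_t W₀ + M_{a−1,b−1}`**: modulo the lower level every monomial `M(j,b−j,i,a−i) w` is `± v_t w` (iterate the `q`-reduction
`min(i,j)` times). [cite: Varadarajan1989, §5.4 (proof of Thm. 22)] [cite: BorelWallach2000, II §4.2] -/
theorem upqLevel_le_span_u21SVec_sup (hV : IsGKModule (uFormGroup (Fin 2) (Fin 1)) ρK ρ𝔤) {c : ℂ}
    (hC : upqCasimirOp ρ𝔤 = algebraMap ℂ (Module.End ℂ V) c) {W₀ : Submodule ℂ V}
    (hW₀ : ∀ (k : (uFormGroup (Fin 2) (Fin 1)).maximalCompact), ∀ w ∈ W₀, ρK k w ∈ W₀) (a b : ℕ) :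
    upqLevel ρ𝔤 W₀ a b ≤ Submodule.span ℂ {v | ∃ t ≤ a + b, ∃ x ∈ W₀, v = u21SVec ρ𝔤 a b t x} ⊔ upqLevel ρ𝔤 W₀ (a - 1) (b - 1) := by
  -- `M(j+m, k, i+m, l) w ≡ (-1)^m M(j, k+m, i, l+m) w` modulo `M_{i+l+m-1, j+k+m-1}` hmm: we only need the case landing in `M_{a-1,b-1}`
  have hred : ∀ (m j k i l : ℕ) {w : V}, w ∈ W₀ → i + l + m = a → j + k + m = b →
      u21Mon ρ𝔤 (j + m) k (i + m) l w - ((-1 : ℂ) ^ m) • u21Mon ρ𝔤 j (k + m) i (l + m) w ∈ upqLevel ρ𝔤 W₀ (a - 1) (b - 1) := by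
    intro m
    induction m with
    | zero => intro j k i l w hw _ _; simp
    | succ m ih =>
      intro j k i l w hw ha hb
      -- one reduction step: `M(j+m+1, k, i+m+1, l) w + M(j+m, k+1, i+m, l+1) w ∈ M_{i+m+l, j+m+k} = M_{a-1, b-1}`
      have h1 := u21Mon_succ_add_u21Mon_succ_apply_mem ρK hV hC hW₀ (j + m) k (i + m) l hw
      rw [show i + m + l = a - 1 by omega, show j + m + k = b - 1 by omega] at h1
      have h2 := ih j (k + 1) i (l + 1) hw (by omega) (by omega)
      rw [show j + (m + 1) = j + m + 1 by ring, show i + (m + 1) = i + m + 1 by ring, show k + (m + 1) = k + 1 + m by ring,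
        show l + (m + 1) = l + 1 + m by ring, pow_succ]
      have : u21Mon ρ𝔤 (j + m + 1) k (i + m + 1) l w - ((-1 : ℂ) ^ m * -1) • u21Mon ρ𝔤 j (k + 1 + m) i (l + 1 + m) w =
          (u21Mon ρ𝔤 (j + m + 1) k (i + m + 1) l w + u21Mon ρ𝔤 (j + m) (k + 1) (i + m) (l + 1) w) -
            (u21Mon ρ𝔤 (j + m) (k + 1) (i + m) (l + 1) w - ((-1 : ℂ) ^ m) • u21Mon ρ𝔤 j (k + 1 + m) i (l + 1 + m) w) := by
        module
      rw [this]
      exact sub_mem h1 h2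
  rw [upqLevel_eq_span_u21Mon ρ𝔤 W₀ a b, Submodule.span_le]
  rintro _ ⟨j, hj, i, hi, w, hw, rfl⟩
  rcases le_total j i with hji | hij
  · -- reduce `j` times: lands on `M(0, b, i-j, a-i+j) = v_{a-i+j}`
    have h := hred j 0 (b - j) (i - j) (a - i) hw (by omega) (by omega)
    rw [Nat.zero_add, show i - j + j = i by omega] at h
    have hv : u21Mon ρ𝔤 0 (b - j + j) (i - j) (a - i + j) w = u21SVec ρ𝔤 a b (a - i + j) w := by
      rw [u21SVec_of_le ρ𝔤 (show a - i + j ≤ a by omega), show b - j + j = b by omega, show a - (a - i + j) = i - j by omega]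
    rw [hv] at h
    have hmem : ((-1 : ℂ) ^ j) • u21SVec ρ𝔤 a b (a - i + j) w ∈ Submodule.span ℂ {v | ∃ t ≤ a + b, ∃ x ∈ W₀, v = u21SVec ρ𝔤 a b t x} :=
      Submodule.smul_mem _ _ (Submodule.subset_span ⟨a - i + j, by omega, w, hw, rfl⟩)
    have := Submodule.add_mem_sup hmem h
    rwa [add_sub_cancel] at this
  · -- reduce `i` times: lands on `M(j-i, b-j+i, 0, a) = ± v_{a+(j-i)}`
    have h := hred i (j - i) (b - j) 0 (a - i) hw (by omega) (by omega)
    rw [Nat.zero_add, show j - i + i = j by omega] at h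
    have hv : u21Mon ρ𝔤 (j - i) (b - j + i) 0 (a - i + i) w = ((-1 : ℂ) ^ (j - i)) • u21SVec ρ𝔤 a b (a + (j - i)) w := by
      rw [u21SVec_add, LinearMap.smul_apply, smul_smul, ← pow_add, ← two_mul, pow_mul, neg_one_sq, one_pow, one_smul,
        show b - j + i = b - (j - i) by omega, Nat.sub_add_cancel hi]
    rw [hv, smul_smul, ← pow_add] at h
    have hmem : ((-1 : ℂ) ^ (i + (j - i))) • u21SVec ρ𝔤 a b (a + (j - i)) w ∈
        Submodule.span ℂ {v | ∃ t ≤ a + b, ∃ x ∈ W₀, v = u21SVec ρ𝔤 a b t x} :=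
      Submodule.smul_mem _ _ (Submodule.subset_span ⟨a + (j - i), by omega, w, hw, rfl⟩)
    have := Submodule.add_mem_sup hmem h
    rwa [add_sub_cancel] at this

/-! ## §2 The string map `Ψ : V(n) ⊗ W₀ → V ⧸ L'` -/

section StrMap

variable {W₀ : Submodule ℂ V} (a b : ℕ) (L' : Submodule ℂ V)

variable (ρ𝔤) in
/-- **`Ψ(w) := Σ_{t=0}^{a+b} [v_t w_t] ∈ V ⧸ L'`** for `w ∈ ⊕_{t=0}^{a+b} W₀` — the string map of level `(a,b)` modulo `L'`.
[cite: Varadarajan1989, §5.4] [cite: Humphreys1972, §7.2] -/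
def u21StrMap (W₀ : Submodule ℂ V) (a b : ℕ) (L' : Submodule ℂ V) : (Fin (a + b + 1) → W₀) →ₗ[ℂ] V ⧸ L' :=
  ∑ t : Fin (a + b + 1), L'.mkQ ∘ₗ u21SVec ρ𝔤 a b t ∘ₗ W₀.subtype ∘ₗ LinearMap.proj t

/-- `Ψ(w) = Σ_{m < a+b+1} [v_m w_m]` as a sum over `ℕ` (components read by ★ `strGet`). [cite: Varadarajan1989, §5.4] -/
theorem u21StrMap_apply (w : Fin (a + b + 1) → W₀) :
    u21StrMap ρ𝔤 W₀ a b L' w = ∑ m ∈ Finset.range (a + b + 1), L'.mkQ (u21SVec ρ𝔤 a b m ((strGet (a + b) w m : W₀) : V)) := by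
  rw [u21StrMap, LinearMap.sum_apply, ← Fin.sum_univ_eq_sum_range (fun m => L'.mkQ (u21SVec ρ𝔤 a b m ((strGet (a + b) w m : W₀) : V)))]
  refine Finset.sum_congr rfl fun t _ => ?_
  rw [strGet_fin]
  rfl

/-- `Ψ(δ_t x) = [v_t x]`. [cite: Varadarajan1989, §5.4] -/
theorem u21StrMap_single (t : Fin (a + b + 1)) (x : W₀) : u21StrMap ρ𝔤 W₀ a b L' (Pi.single t x) = L'.mkQ (u21SVec ρ𝔤 a b t (x : V)) := by
  rw [u21StrMap, LinearMap.sum_apply,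
    Finset.sum_eq_single t (fun t' _ ht' => by simp [Pi.single_eq_of_ne ht']) (fun h => absurd (Finset.mem_univ t) h)]
  simp [LinearMap.comp_apply]

variable {a b L'}

/-- **`Ψ` intertwines `h_S` with `h̄`** (exactly). [cite: Varadarajan1989, §5.4] [cite: Humphreys1972, §7.2 Lemma (a)] -/
theorem u21StrMap_strH (hW₀h : ∀ x ∈ W₀, u21h ρ𝔤 x ∈ W₀) (hLh : L' ≤ L'.comap (u21h ρ𝔤)) (w : Fin (a + b + 1) → W₀) :
    u21StrMap ρ𝔤 W₀ a b L' (strH ((u21h ρ𝔤).restrict hW₀h) (a + b) w) = L'.mapQ L' (u21h ρ𝔤) hLh (u21StrMap ρ𝔤 W₀ a b L' w) := by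
  rw [u21StrMap_apply, u21StrMap_apply, map_sum]
  refine Finset.sum_congr rfl fun m hm => ?_
  rw [Finset.mem_range] at hm
  rw [Submodule.mkQ_apply, Submodule.mkQ_apply, Submodule.mapQ_apply, strGet_strH, Submodule.coe_add, Submodule.coe_smul, LinearMap.coe_restrict_apply,
    ← Module.End.mul_apply, u21h_mul_u21SVec (show m ≤ a + b by omega), LinearMap.add_apply, Module.End.mul_apply, LinearMap.smul_apply, map_add, map_smul]

/-- **`Ψ` intertwines `e_S` with `ē`** (the string congruence for `e` modulo `M_{a−1,b−1} ⊆ L'`, summed and re-indexed).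
[cite: Varadarajan1989, §5.4] [cite: Humphreys1972, §7.2 Lemma (b)] -/
theorem u21StrMap_strE (hV : IsGKModule (uFormGroup (Fin 2) (Fin 1)) ρK ρ𝔤) {c : ℂ} (hC : upqCasimirOp ρ𝔤 = algebraMap ℂ (Module.End ℂ V) c)
    (hW₀ : ∀ (k : (uFormGroup (Fin 2) (Fin 1)).maximalCompact), ∀ w ∈ W₀, ρK k w ∈ W₀) (hW₀e : ∀ x ∈ W₀, u21e ρ𝔤 x ∈ W₀)
    (hL : upqLevel ρ𝔤 W₀ (a - 1) (b - 1) ≤ L') (hLe : L' ≤ L'.comap (u21e ρ𝔤)) (w : Fin (a + b + 1) → W₀) :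
    u21StrMap ρ𝔤 W₀ a b L' (strE ((u21e ρ𝔤).restrict hW₀e) (a + b) w) = L'.mapQ L' (u21e ρ𝔤) hLe (u21StrMap ρ𝔤 W₀ a b L' w) := by
  -- termwise: `[e (v_m w_m)] = [v_m (e w_m)] + m [v_{m-1} w_m]` and `[v_m (e_S w)_m] = [v_m (e w_m)] + (m+1) [v_m w_{m+1}]`
  have hR : ∀ m ∈ Finset.range (a + b + 1), L'.mapQ L' (u21e ρ𝔤) hLe (L'.mkQ (u21SVec ρ𝔤 a b m ((strGet (a + b) w m : W₀) : V))) =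
      L'.mkQ (u21SVec ρ𝔤 a b m (u21e ρ𝔤 ((strGet (a + b) w m : W₀) : V))) +
        (m : ℂ) • L'.mkQ (u21SVec ρ𝔤 a b (m - 1) ((strGet (a + b) w m : W₀) : V)) := by
    intro m hm
    rw [Finset.mem_range] at hm
    rw [Submodule.mkQ_apply, Submodule.mkQ_apply, Submodule.mkQ_apply, Submodule.mapQ_apply, ← Submodule.Quotient.mk_smul, ← Submodule.Quotient.mk_add,
      Submodule.Quotient.eq]
    exact hL (u21e_u21SVec_apply_sub_mem ρK hV hC hW₀ (show m ≤ a + b by omega) (strGet (a + b) w m).2)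
  have hL' : ∀ m ∈ Finset.range (a + b + 1), L'.mkQ (u21SVec ρ𝔤 a b m ((strGet (a + b) (strE ((u21e ρ𝔤).restrict hW₀e) (a + b) w) m : W₀) : V)) =
      L'.mkQ (u21SVec ρ𝔤 a b m (u21e ρ𝔤 ((strGet (a + b) w m : W₀) : V))) +
        ((m : ℂ) + 1) • L'.mkQ (u21SVec ρ𝔤 a b m ((strGet (a + b) w (m + 1) : W₀) : V)) := by
    intro m _
    rw [strGet_strE, Submodule.coe_add, Submodule.coe_smul, LinearMap.coe_restrict_apply, map_add, map_smul, map_add, map_smul]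
  rw [u21StrMap_apply, u21StrMap_apply, map_sum, Finset.sum_congr rfl hL', Finset.sum_congr rfl hR, Finset.sum_add_distrib, Finset.sum_add_distrib]
  congr 1
  -- re-index: both sides equal `Σ_{m < n} (m+1) [v_m w_{m+1}]`
  rw [Finset.sum_range_succ, strGet_of_le (a + b) w le_rfl, Submodule.coe_zero, map_zero, map_zero, smul_zero, add_zero,
    Finset.sum_range_succ' _ (a + b), Nat.cast_zero, zero_smul, add_zero]
  refine Finset.sum_congr rfl fun m _ => ?_
  rw [Nat.add_sub_cancel, Nat.cast_succ]

/-- **`Ψ` intertwines `f_S` with `f̄`** (the string congruence for `f` modulo `M_{a−1,b−1} ⊆ L'`, summed and re-indexed).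
[cite: Varadarajan1989, §5.4] [cite: Humphreys1972, §7.2 Lemma (c)] -/
theorem u21StrMap_strF (hV : IsGKModule (uFormGroup (Fin 2) (Fin 1)) ρK ρ𝔤) {c : ℂ} (hC : upqCasimirOp ρ𝔤 = algebraMap ℂ (Module.End ℂ V) c)
    (hW₀ : ∀ (k : (uFormGroup (Fin 2) (Fin 1)).maximalCompact), ∀ w ∈ W₀, ρK k w ∈ W₀) (hW₀f : ∀ x ∈ W₀, u21f ρ𝔤 x ∈ W₀)
    (hL : upqLevel ρ𝔤 W₀ (a - 1) (b - 1) ≤ L') (hLf : L' ≤ L'.comap (u21f ρ𝔤)) (w : Fin (a + b + 1) → W₀) :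
    u21StrMap ρ𝔤 W₀ a b L' (strF ((u21f ρ𝔤).restrict hW₀f) (a + b) w) = L'.mapQ L' (u21f ρ𝔤) hLf (u21StrMap ρ𝔤 W₀ a b L' w) := by
  have hR : ∀ m ∈ Finset.range (a + b + 1), L'.mapQ L' (u21f ρ𝔤) hLf (L'.mkQ (u21SVec ρ𝔤 a b m ((strGet (a + b) w m : W₀) : V))) =
      L'.mkQ (u21SVec ρ𝔤 a b m (u21f ρ𝔤 ((strGet (a + b) w m : W₀) : V))) +
        (((a + b : ℕ) : ℂ) - m) • L'.mkQ (u21SVec ρ𝔤 a b (m + 1) ((strGet (a + b) w m : W₀) : V)) := by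
    intro m hm
    rw [Finset.mem_range] at hm
    rw [Submodule.mkQ_apply, Submodule.mkQ_apply, Submodule.mkQ_apply, Submodule.mapQ_apply, ← Submodule.Quotient.mk_smul, ← Submodule.Quotient.mk_add,
      Submodule.Quotient.eq]
    exact hL (u21f_u21SVec_apply_sub_mem ρK hV hC hW₀ (show m ≤ a + b by omega) (strGet (a + b) w m).2)
  rw [u21StrMap_apply, u21StrMap_apply, map_sum, Finset.sum_congr rfl hR, Finset.sum_add_distrib]
  -- left: split off `m = 0` and shift
  rw [Finset.sum_range_succ' (fun m => L'.mkQ (u21SVec ρ𝔤 a b m ((strGet (a + b) (strF ((u21f ρ𝔤).restrict hW₀f) (a + b) w) m : W₀) : V))) (a + b),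
    strGet_strF_zero, LinearMap.coe_restrict_apply]
  have hL' : ∀ m ∈ Finset.range (a + b), L'.mkQ (u21SVec ρ𝔤 a b (m + 1) ((strGet (a + b) (strF ((u21f ρ𝔤).restrict hW₀f) (a + b) w) (m + 1) : W₀) : V)) =
      L'.mkQ (u21SVec ρ𝔤 a b (m + 1) (u21f ρ𝔤 ((strGet (a + b) w (m + 1) : W₀) : V))) +
        (((a + b : ℕ) : ℂ) - m) • L'.mkQ (u21SVec ρ𝔤 a b (m + 1) ((strGet (a + b) w m : W₀) : V)) := by
    intro m _
    rw [strGet_strF_succ, Submodule.coe_add, Submodule.coe_smul, LinearMap.coe_restrict_apply, map_add, map_smul, map_add, map_smul]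
  rw [Finset.sum_congr rfl hL', Finset.sum_add_distrib]
  -- right: the `m = n` term of the second sum vanishes (`n - n = 0`), the first sum splits the same way
  rw [Finset.sum_range_succ (fun m => (((a + b : ℕ) : ℂ) - m) • L'.mkQ (u21SVec ρ𝔤 a b (m + 1) ((strGet (a + b) w m : W₀) : V))) (a + b), sub_self,
    zero_smul, add_zero, Finset.sum_range_succ' (fun m => L'.mkQ (u21SVec ρ𝔤 a b m (u21f ρ𝔤 ((strGet (a + b) w m : W₀) : V)))) (a + b)]
  abel

/-- **The image of the level `M_{a,b}` in `V ⧸ L'` lies in the range of `Ψ`** (`M_{a−1,b−1} ⊆ L'`). [cite: Varadarajan1989, §5.4] [cite: BorelWallach2000, II §4.2] -/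
theorem map_mkQ_upqLevel_le_range_u21StrMap (hV : IsGKModule (uFormGroup (Fin 2) (Fin 1)) ρK ρ𝔤) {c : ℂ}
    (hC : upqCasimirOp ρ𝔤 = algebraMap ℂ (Module.End ℂ V) c)
    (hW₀ : ∀ (k : (uFormGroup (Fin 2) (Fin 1)).maximalCompact), ∀ w ∈ W₀, ρK k w ∈ W₀) (hL : upqLevel ρ𝔤 W₀ (a - 1) (b - 1) ≤ L') :
    (upqLevel ρ𝔤 W₀ a b).map L'.mkQ ≤ LinearMap.range (u21StrMap ρ𝔤 W₀ a b L') := by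
  refine (Submodule.map_mono (upqLevel_le_span_u21SVec_sup ρK hV hC hW₀ a b)).trans ?_
  rw [Submodule.map_sup, Submodule.map_span, sup_le_iff, Submodule.span_le]
  refine ⟨?_, ?_⟩
  · rintro _ ⟨v, ⟨t, ht, x, hx, rfl⟩, rfl⟩
    refine ⟨Pi.single ⟨t, by omega⟩ ⟨x, hx⟩, ?_⟩
    rw [u21StrMap_single]
  · rw [Submodule.map_le_iff_le_comap]
    intro v hv
    rw [Submodule.mem_comap, Submodule.mkQ_apply, (Submodule.Quotient.mk_eq_zero L').mpr (hL hv)]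
    exact Submodule.zero_mem _

/-! ## §3 The bound on the highest weight vectors of a level modulo lower terms -/

/-- The `𝔰𝔩₂` relation `[e, f] = h` restricted to `W₀`. [cite: Humphreys1972, §7.2] -/
theorem u21_restrict_ef (hW₀e : ∀ x ∈ W₀, u21e ρ𝔤 x ∈ W₀) (hW₀f : ∀ x ∈ W₀, u21f ρ𝔤 x ∈ W₀) (hW₀h : ∀ x ∈ W₀, u21h ρ𝔤 x ∈ W₀) :
    (u21e ρ𝔤).restrict hW₀e * (u21f ρ𝔤).restrict hW₀f - (u21f ρ𝔤).restrict hW₀f * (u21e ρ𝔤).restrict hW₀e = (u21h ρ𝔤).restrict hW₀h := by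
  ext x
  have h := LinearMap.congr_fun (u21e_mul_u21f_sub ρ𝔤) (x : V)
  simpa [LinearMap.coe_restrict_apply] using h

/-- The `𝔰𝔩₂` relation `[h, e] = 2e` restricted to `W₀`. [cite: Humphreys1972, §7.2] -/
theorem u21_restrict_he (hW₀e : ∀ x ∈ W₀, u21e ρ𝔤 x ∈ W₀) (hW₀h : ∀ x ∈ W₀, u21h ρ𝔤 x ∈ W₀) :
    (u21h ρ𝔤).restrict hW₀h * (u21e ρ𝔤).restrict hW₀e - (u21e ρ𝔤).restrict hW₀e * (u21h ρ𝔤).restrict hW₀h = (2 : ℂ) • (u21e ρ𝔤).restrict hW₀e := by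
  ext x
  have h := LinearMap.congr_fun (u21h_mul_u21e_sub ρ𝔤) (x : V)
  simpa [LinearMap.coe_restrict_apply] using h

/-- The `𝔰𝔩₂` relation `[h, f] = −2f` restricted to `W₀`. [cite: Humphreys1972, §7.2] -/
theorem u21_restrict_hf (hW₀f : ∀ x ∈ W₀, u21f ρ𝔤 x ∈ W₀) (hW₀h : ∀ x ∈ W₀, u21h ρ𝔤 x ∈ W₀) :
    (u21h ρ𝔤).restrict hW₀h * (u21f ρ𝔤).restrict hW₀f - (u21f ρ𝔤).restrict hW₀f * (u21h ρ𝔤).restrict hW₀h = -((2 : ℂ) • (u21f ρ𝔤).restrict hW₀f) := by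
  ext x
  have h := LinearMap.congr_fun (u21h_mul_u21f_sub ρ𝔤) (x : V)
  simpa [LinearMap.coe_restrict_apply] using h

/-- **THE PER-LEVEL BOUND.**  For a `(𝔤, K)`-module `V` of `U(2,1)` with scalar Casimir, a finite-dimensional `K`-stable `W₀` (stable under `e, f, h`),
and a subspace `L' ⊇ M_{a−1,b−1}` stable under `e, f, h`: the `ē`-killed `h̄`-eigenvectors of eigenvalue `μ` lying in the image of the level `M_{a,b}` in
`V ⧸ L'` span a space of dimension **at most `dim (W₀)_{μ−(a+b)}`**, the `(μ − a − b)`-eigenspace of `h` on `W₀` — so there are none unless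
`μ − (a+b)` is an `h`-weight of `W₀` («the highest weights of `𝓗^{a,b} ⊗ W₀ ≅ V(a+b) ⊗ W₀`»).
[cite: Varadarajan1989, §5.4 Thm. 22] [cite: Humphreys1972, §7.2 Theorem] [cite: BorelWallach2000, II §4.2] -/
theorem finrank_weightVectors_level_le (hV : IsGKModule (uFormGroup (Fin 2) (Fin 1)) ρK ρ𝔤) {c : ℂ}
    (hC : upqCasimirOp ρ𝔤 = algebraMap ℂ (Module.End ℂ V) c) [FiniteDimensional ℂ W₀]
    (hW₀ : ∀ (k : (uFormGroup (Fin 2) (Fin 1)).maximalCompact), ∀ w ∈ W₀, ρK k w ∈ W₀) (hW₀e : ∀ x ∈ W₀, u21e ρ𝔤 x ∈ W₀)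
    (hW₀f : ∀ x ∈ W₀, u21f ρ𝔤 x ∈ W₀) (hW₀h : ∀ x ∈ W₀, u21h ρ𝔤 x ∈ W₀) (hL : upqLevel ρ𝔤 W₀ (a - 1) (b - 1) ≤ L')
    (hLe : L' ≤ L'.comap (u21e ρ𝔤)) (hLf : L' ≤ L'.comap (u21f ρ𝔤)) (hLh : L' ≤ L'.comap (u21h ρ𝔤)) (μ : ℂ) :
    Module.finrank ℂ ↥(LinearMap.ker (L'.mapQ L' (u21e ρ𝔤) hLe) ⊓ Module.End.eigenspace (L'.mapQ L' (u21h ρ𝔤) hLh) μ ⊓ (upqLevel ρ𝔤 W₀ a b).map L'.mkQ) ≤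
      Module.finrank ℂ ↥(Module.End.eigenspace ((u21h ρ𝔤).restrict hW₀h) (μ - ((a + b : ℕ) : ℂ))) := by
  have hbig : LinearMap.ker (L'.mapQ L' (u21e ρ𝔤) hLe) ⊓ Module.End.eigenspace (L'.mapQ L' (u21h ρ𝔤) hLh) μ ⊓ (upqLevel ρ𝔤 W₀ a b).map L'.mkQ ≤
      LinearMap.ker (L'.mapQ L' (u21e ρ𝔤) hLe) ⊓ Module.End.eigenspace (L'.mapQ L' (u21h ρ𝔤) hLh) μ ⊓ LinearMap.range (u21StrMap ρ𝔤 W₀ a b L') :=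
    inf_le_inf_left _ (map_mkQ_upqLevel_le_range_u21StrMap ρK hV hC hW₀ hL)
  haveI : FiniteDimensional ℂ ↥(LinearMap.ker (L'.mapQ L' (u21e ρ𝔤) hLe) ⊓ Module.End.eigenspace (L'.mapQ L' (u21h ρ𝔤) hLh) μ ⊓
      LinearMap.range (u21StrMap ρ𝔤 W₀ a b L')) := Submodule.finiteDimensional_inf_right _ _
  refine (Submodule.finrank_mono hbig).trans ?_
  exact finrank_weightVectors_range_le ((u21e ρ𝔤).restrict hW₀e) ((u21f ρ𝔤).restrict hW₀f) ((u21h ρ𝔤).restrict hW₀h) (a + b)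
    (u21_restrict_ef hW₀e hW₀f hW₀h) (u21_restrict_he hW₀e hW₀h) (u21_restrict_hf hW₀f hW₀h) (u21StrMap ρ𝔤 W₀ a b L') _ _ _
    (u21StrMap_strE ρK hV hC hW₀ hW₀e hL hLe) (u21StrMap_strF ρK hV hC hW₀ hW₀f hL hLf) (u21StrMap_strH hW₀h hLh) μ

end StrMap

end Literature.NumberTheory.Automorphic

end
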